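import Summits.HodgeConjecture.HodgeConjecture.Theses.GenericDivisibility
import Literature.AlgebraicGeometry.Motives.UnramifiedCohomology
import HarnessLib

/-!
# Route GenericDivisibility — crux `HodgeClassesGenericallyDivisible` (stmt-HodgeConjecture-18466), line `Sketch`: stub `stub_coprimeAssembly`

Registered stub 2 of the lead's skeleton `Cruxes/HodgeClassesGenericallyDivisible/Lines/Sketch.lean`
(coprime assembly): on an irreducible `ℂ`-scheme `X`, if an integral class `z ∈ H^q(X(ℂ); ℤ)` is
divisible by `a` on the complex points of one non-empty Zariski open `X ∖ Z₁` and by `b` on another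
`X ∖ Z₂`, with `a`, `b` coprime, then it is divisible by `a * b` on the complex points of
`X ∖ (Z₁ ∪ Z₂)`, which is non-empty because `X` is irreducible (two non-empty opens meet).
With Bézout over `ℕ`, `a m = b t + 1` (`b ≥ 2`; the cases `b ≤ 1` are immediate): if
`a • y_a = z|` and `b • y_b = z|` on the common open then
`(a b) • (m • y_b - t • y_a) = (a m) • z| - (b t) • z| = z|`.
-/

noncomputable section

-- every declaration of this problem lives in `Summit.HodgeConjecture.HodgeConjecture.…` (summit = sub-problem)
set_option linter.dupNamespace false

open CategoryTheory AlgebraicGeometry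
open Literature.AlgebraicGeometry.Motives Literature.AlgebraicGeometry.HodgeTheory
  Literature.AlgebraicTopology.SingularHomology

namespace Summit.HodgeConjecture.HodgeConjecture.Theorems

/-- In an irreducible topological space the union of two proper closed subsets is proper (their
complements are non-empty opens, which meet). [folklore] -/
theorem genericDivisibility_union_ne_univ {α : Type*} [TopologicalSpace α] [IrreducibleSpace α]
    {Z₁ Z₂ : Set α} (h₁ : IsClosed Z₁) (h₂ : IsClosed Z₂) (h₁u : Z₁ ≠ Set.univ)
    (h₂u : Z₂ ≠ Set.univ) : Z₁ ∪ Z₂ ≠ Set.univ := by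
  intro h
  obtain ⟨x₁, hx₁⟩ := Set.nonempty_compl.2 h₁u
  obtain ⟨x₂, hx₂⟩ := Set.nonempty_compl.2 h₂u
  obtain ⟨x, -, hx, hx'⟩ := (PreirreducibleSpace.isPreirreducible_univ (X := α)) Z₁ᶜ Z₂ᶜ
    h₁.isOpen_compl h₂.isOpen_compl ⟨x₁, Set.mem_univ _, hx₁⟩ ⟨x₂, Set.mem_univ _, hx₂⟩
  have hxu : x ∈ Z₁ ∪ Z₂ := h ▸ Set.mem_univ x
  exact hxu.elim hx hx'

/-- Restriction from `X(ℂ)` to `(X ∖ Z')(ℂ)` factors through `(X ∖ Z)(ℂ)` for `Z ⊆ Z'`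
(functoriality of `H^q` along `(X ∖ Z')(ℂ) ↪ (X ∖ Z)(ℂ) ↪ X(ℂ)`). [cite: GrothendieckTopology1969, §1] -/
theorem genericDivisibility_restrictToCompl_comp_map (A : Type) [CommRing A] {X : SchemeOver ℂ}
    (q : ℕ) {Z Z' : Set X.left} (h : Z ⊆ Z') :
    restrictToCompl A X q Z ≫ singularCohomology.map A A (complexPointsComplInclusion h) q =
      restrictToCompl A X q Z' :=
  (singularCohomology.map_comp A A (complexPointsComplInclusion h)
    (⟨Subtype.val, continuous_subtype_val⟩ : C(complexPointsCompl X Z, ComplexPoints X)) q).symm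

/-- Divisibility by `a` on `(X ∖ Z)(ℂ)` persists on `(X ∖ Z')(ℂ)` for `Z ⊆ Z'` (restrict the
witness). [cite: GrothendieckTopology1969, §1] -/
theorem genericDivisibility_nsmul_eq_restrictToCompl_of_subset {X : SchemeOver ℂ} (q : ℕ)
    {Z Z' : Set X.left} (h : Z ⊆ Z') (z : singularCohomology ℤ ℤ (ComplexPoints X) q) (a : ℕ)
    {y : singularCohomology ℤ ℤ (complexPointsCompl X Z) q} (hy : a • y = restrictToCompl ℤ X q Z z) :
    a • singularCohomology.map ℤ ℤ (complexPointsComplInclusion h) q y =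
      restrictToCompl ℤ X q Z' z := by
  rw [← map_nsmul, hy, ← CategoryTheory.comp_apply, genericDivisibility_restrictToCompl_comp_map]

/-- **Stub 2 of line `Sketch` (crux C1): coprime assembly.** On an irreducible `ℂ`-scheme, an
integral class divisible by `a` on the complex points of one non-empty Zariski open and by `b` on
another, `a` and `b` coprime, is divisible by `a * b` on the complex points of their (non-empty)
intersection: Bézout `a m = b t + 1` and `y = m • y_b - t • y_a`. [folklore] -/
theorem stub_coprimeAssembly : ∀ ⦃X : SchemeOver ℂ⦄ [IrreducibleSpace X.left] (q : ℕ)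
    (z : singularCohomology ℤ ℤ (ComplexPoints X) q) (a b : ℕ), a.Coprime b →
    (∃ Z : Set X.left, IsClosed Z ∧ Z ≠ Set.univ ∧
      ∃ y : singularCohomology ℤ ℤ (complexPointsCompl X Z) q, a • y = restrictToCompl ℤ X q Z z) →
    (∃ Z : Set X.left, IsClosed Z ∧ Z ≠ Set.univ ∧
      ∃ y : singularCohomology ℤ ℤ (complexPointsCompl X Z) q, b • y = restrictToCompl ℤ X q Z z) →
    ∃ Z : Set X.left, IsClosed Z ∧ Z ≠ Set.univ ∧
      ∃ y : singularCohomology ℤ ℤ (complexPointsCompl X Z) q, (a * b) • y = restrictToCompl ℤ X q Z z := by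
  intro X _ q z a b hab ha hb
  obtain ⟨Z₁, hZ₁, hZ₁u, ya, hya⟩ := ha
  obtain ⟨Z₂, hZ₂, hZ₂u, yb, hyb⟩ := hb
  refine ⟨Z₁ ∪ Z₂, hZ₁.union hZ₂, genericDivisibility_union_ne_univ hZ₁ hZ₂ hZ₁u hZ₂u, ?_⟩
  -- the two witnesses on the common open `X ∖ (Z₁ ∪ Z₂)`
  set y₁ := singularCohomology.map ℤ ℤ
    (complexPointsComplInclusion (Set.subset_union_left : Z₁ ⊆ Z₁ ∪ Z₂)) q ya with hy₁
  set y₂ := singularCohomology.map ℤ ℤ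
    (complexPointsComplInclusion (Set.subset_union_right : Z₂ ⊆ Z₁ ∪ Z₂)) q yb with hy₂
  set r := restrictToCompl ℤ X q (Z₁ ∪ Z₂) z with hr
  have ha' : a • y₁ = r :=
    genericDivisibility_nsmul_eq_restrictToCompl_of_subset q Set.subset_union_left z a hya
  have hb' : b • y₂ = r :=
    genericDivisibility_nsmul_eq_restrictToCompl_of_subset q Set.subset_union_right z b hyb
  -- Bézout over `ℕ` (only the `ℕ`-action is used): `a m = b t + 1` for `b ≥ 2`
  rcases Nat.lt_or_ge b 2 with hb2 | hb2
  · interval_cases b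
    · -- `b = 0`: then `a = 1` and `r = 0 • y₂`
      obtain rfl : a = 1 := (Nat.coprime_zero_right a).1 hab
      exact ⟨y₂, by rw [Nat.one_mul]; exact hb'⟩
    · exact ⟨y₁, by rw [Nat.mul_one]; exact ha'⟩
  · obtain ⟨m, -, hm⟩ := Nat.exists_mul_mod_eq_one_of_coprime hab hb2
    set t := a * m / b with ht
    have hmt : a * m = b * t + 1 := by
      have h := Nat.div_add_mod (a * m) b
      rw [← ht, hm] at h
      omega
    refine ⟨m • y₂ - t • y₁, ?_⟩
    have e1 : (a * b) • (m • y₂) = (a * m) • r := by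
      rw [← hb', smul_smul, smul_smul]
      congr 1
      ring
    have e2 : (a * b) • (t • y₁) = (b * t) • r := by
      rw [← ha', smul_smul, smul_smul]
      congr 1
      ring
    rw [nsmul_sub, e1, e2, hmt, succ_nsmul, add_sub_cancel_left]

end Summit.HodgeConjecture.HodgeConjecture.Theorems

end
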